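import Summits.KontsevichZagierPeriods.KontsevichZagierPeriods.Theorems.TerasomaMultiplicationNegativeBranchToMaxCell

/-!
# `NegativeBranchToMaxCell` (stmt-KontsevichZagierPeriods-14675) — part 5: the pinned representations exist

Non-vacuity of the item and the form the crux assembly (`MultiplicationThree` via the bolza line)
consumes. The three moves of parts 1–3 are bijections with exact Jacobian identities, so absolute
convergence TRANSPORTS along the chain in either direction (Mathlib's Jacobian criterion
`integrableOn_image_iff_integrableOn_abs_det_fderiv_smul`); starting from the tree's pinned simplex
representation `simplexRep s hs` (`Theorems/MultiplicationThree/Negative/Pinned.lean`, Dirichlet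
integrability) restricted to the max cell `M₃` we obtain, with NO estimate:

* `maxRep s hs = [M₃, (σ₁σ₂σ₃)^(s−1)]` (a restriction of `simplexRep`; `isSemialgebraic_maxCell`);
* `tFun s` is integrable on the middle cell (unshear) and on `Σ_neg` (the Möbius involution read
  from the middle cell: `tFun_eq_tFun_mobius_of`, `image_mobius_midCell`);
* the literal route integrand `negFun s = u^(s−1)/√(a²(3−a)² − 4ua)` is integrable
  (`integrableOn_negFun`) and `ℚ`-semialgebraic (`isSemialgebraicFunOn_negFun`) on `Σ_neg`, whence
  THE PINNED NEGATIVE-BRANCH REPRESENTATION `negRep s hs = [Σ_neg, negFun s]` for every rational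
  `s > 0`, and `negRep_equivalent_maxRep : Equivalent (negRep s hs) (maxRep s hs)` (the item,
  instantiated). Sources: Kontsevich–Zagier 2001 §1.1–1.2.
-/

noncomputable section

open MeasureTheory Set Real
open scoped BigOperators

namespace Summit.KontsevichZagierPeriods.TerasomaMultiplication.NegativeBranchToMaxCell

open Literature.NumberTheory.Transcendental
open Literature.NumberTheory.Transcendental.KZ
open Literature.ModelTheory.ExponentialFields (IsSemialgebraic)
open MvPolynomial (aeval X C)
open Summit.KontsevichZagierPeriods.TerasomaMultiplication.MultiplicationThreeNegative
  (triangle simplexFun simplexRep isSemialgebraic_triangle)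

/-! ### The max cell is semialgebraic; the pinned max-cell representation -/

/-- Defining polynomials of `M₃`. [folklore] -/
def maxCellPolys : Fin 4 → MvPolynomial (Fin 2) ℚ := ![X 0, X 1, 3 - 2 * X 0 - X 1, 3 - X 0 - 2 * X 1]

/-- `M₃` is `ℚ`-semialgebraic. [folklore] -/
theorem isSemialgebraic_maxCell : IsSemialgebraic ℚ maxCell := by
  have : maxCell = {x | ∀ l, 0 < aeval x (maxCellPolys l)} := by
    ext x
    simp only [maxCell, mem_setOf_eq, Fin.forall_fin_succ, maxCellPolys, Matrix.cons_val_zero,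
      Matrix.cons_val_succ, map_sub, map_mul, MvPolynomial.aeval_X, map_ofNat]
    constructor
    · rintro ⟨h0, h1, h2, h3⟩; exact ⟨h0, h1, by linarith, by linarith, fun i => Fin.elim0 i⟩
    · rintro ⟨h0, h1, h2, h3, -⟩; exact ⟨h0, h1, by linarith, by linarith⟩
  rw [this]; exact isSemialgebraic_setOf_forall_aeval_pos _

/-- `M₃` is measurable. [folklore] -/
theorem measurableSet_maxCell : MeasurableSet maxCell :=
  IsSemialgebraic.measurableSet_holds isSemialgebraic_maxCell

/-- The middle cell is measurable. [folklore] -/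
theorem measurableSet_midCell : MeasurableSet midCell :=
  IsSemialgebraic.measurableSet_holds isSemialgebraic_midCell

/-- `M₃ ⊆ Δ`. [folklore] -/
theorem maxCell_subset_triangle : maxCell ⊆ triangle := fun _ ⟨h0, h1, h2, _⟩ =>
  ⟨h0, h1, by linarith⟩

/-- **The pinned max-cell representation** `[M₃, (σ₁σ₂σ₃)^(s−1)]`, `s > 0` rational: the
restriction of the tree's pinned simplex representation. [folklore] -/
def maxRep (s : ℚ) (hs : 0 < s) : IntegralRep 2 :=
  (simplexRep s hs).restrict maxCell isSemialgebraic_maxCell maxCell_subset_triangle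

/-- Domain of `maxRep`. [folklore] -/
@[simp] theorem maxRep_domain (s : ℚ) (hs : 0 < s) : (maxRep s hs).domain = maxCell := rfl

/-- Integrand of `maxRep`. [folklore] -/
@[simp] theorem maxRep_integrand (s : ℚ) (hs : 0 < s) : (maxRep s hs).integrand = simplexFun s := rfl

/-! ### Transport of absolute convergence down the chain -/

/-- `tFun s` is integrable on the middle cell (transported from `M₃` through the unshear). [folklore] -/
theorem integrableOn_tFun_midCell_of_pos {s : ℚ} (hs : 0 < s) : IntegrableOn (tFun s) midCell := by
  have h := (integrableOn_image_iff_integrableOn_abs_det_fderiv_smul volume measurableSet_midCell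
    (fun x hx => (hasFDerivAt_unshear
      (show (0:ℝ) < x 1 by obtain ⟨h0, -, h2, -⟩ := hx; linarith).ne'
      (disc_pos_of_mem_midCell hx)).hasFDerivWithinAt) injOn_unshear (simplexFun s)).mp
    (by rw [image_unshear_midCell]
        exact (maxRep s hs).integrableOn)
  refine h.congr_fun (fun x hx => ?_) measurableSet_midCell
  show |(unshear' x).det| * simplexFun s (unshear x) = tFun s x
  rw [tFun_eq_simplexFun_unshear hx, mul_comm]

/-- The Jacobian identity of the Möbius move from its three ingredients (pole avoided, `t < 1`,
`Q > 0`) — valid on `Σ_neg` AND on the middle cell. [folklore] -/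
theorem tFun_eq_tFun_mobius_of {s : ℚ} {x : Fin 2 → ℝ} (hd : 2 * x 1 + x 0 - 3 < 0) (ht : x 0 < 1)
    (hQpos : 0 < Qf (x 1) (lev (x 0))) : tFun s x = tFun s (mobius x) * |(mobius' x).det| := by
  have h3 : 0 < 3 - x 0 := by linarith
  have h1 : 0 < 1 - x 0 := by linarith
  have hQ : 0 < Real.sqrt (Qf (x 1) (lev (x 0))) := Real.sqrt_pos.2 hQpos
  have hsq : Real.sqrt (Qf (mobius x 1) (lev (x 0))) =
      3 * (3 - x 0) * (1 - x 0) / (2 * x 1 + x 0 - 3) ^ 2 * Real.sqrt (Qf (x 1) (lev (x 0))) := by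
    rw [Qf_mobius hd.ne, Real.sqrt_mul (sq_nonneg _), Real.sqrt_sq (by positivity)]
  rw [det_mobius']
  simp only [tFun, mobius_apply_zero]
  rw [hsq]
  set D := 2 * x 1 + x 0 - 3 with hD
  set A := 3 - x 0 with hA
  set B := 1 - x 0 with hB
  set R := Real.sqrt (Qf (x 1) (lev (x 0))) with hR
  have hD0 : D ≠ 0 := hd.ne
  have hc : 0 < 3 * A * B / D ^ 2 := by positivity
  rw [show 3 * A * (x 0 - 1) / D ^ 2 = -(3 * A * B / D ^ 2) by rw [hB]; ring, abs_neg,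
    abs_of_pos hc]
  field_simp

/-- The Möbius move is injective on the middle cell. [folklore] -/
theorem injOn_mobius_midCell : InjOn mobius midCell := fun x hx y hy hxy => by
  rw [← mobius_mobius (den_neg_of_mem_midCell hx).ne (by linarith [hx.2.1]) (by linarith [hx.2.1]),
    ← mobius_mobius (den_neg_of_mem_midCell hy).ne (by linarith [hy.2.1]) (by linarith [hy.2.1]), hxy]

/-- The Möbius move maps the middle cell ONTO `Σ_neg`. [folklore] -/
theorem image_mobius_midCell : mobius '' midCell = negCell := by
  refine mapsTo_mobius_midCell.image_subset.antisymm fun y hy => ?_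
  exact ⟨mobius y, mapsTo_mobius_negCell hy,
    mobius_mobius (den_neg_of_mem_negCell hy).ne (by linarith [hy.2.1]) (by linarith [hy.2.1])⟩

/-- `tFun s` is integrable on `Σ_neg` (read back from the middle cell through the involution). [folklore] -/
theorem integrableOn_tFun_negCell_of_pos {s : ℚ} (hs : 0 < s) : IntegrableOn (tFun s) negCell := by
  have h := (integrableOn_image_iff_integrableOn_abs_det_fderiv_smul volume measurableSet_midCell
    (fun x hx => (hasFDerivAt_mobius (den_neg_of_mem_midCell hx).ne).hasFDerivWithinAt)
    injOn_mobius_midCell (tFun s)).mpr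
    ((integrableOn_tFun_midCell_of_pos hs).congr_fun (fun x hx => by
      show tFun s x = |(mobius' x).det| * tFun s (mobius x)
      rw [tFun_eq_tFun_mobius_of (den_neg_of_mem_midCell hx) hx.2.1 (Qf_pos_of_mem_midCell hx),
        mul_comm]) measurableSet_midCell)
  rwa [image_mobius_midCell] at h

/-- **The route's negative-branch integrand is absolutely integrable on `Σ_neg`** for every
rational `s > 0` (read back through the level chart; the singularities `a → 0⁻`, `a → −∞`, `u → 0`
need no separate estimate). [folklore] -/
theorem integrableOn_negFun {s : ℚ} (hs : 0 < s) : IntegrableOn (negFun s) negCell := by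
  have h := (integrableOn_image_iff_integrableOn_abs_det_fderiv_smul volume measurableSet_negCell
    (fun x _ => (hasFDerivAt_rootChart x).hasFDerivWithinAt) injOn_rootChart (negFun s)).mpr
    ((integrableOn_tFun_negCell_of_pos hs).congr_fun (fun x hx => by
      show tFun s x = |(rootChart' x).det| * negFun s (rootChart x)
      rw [tFun_eq_negFun_rootChart hx, mul_comm]) measurableSet_negCell)
  rwa [image_rootChart_negCell] at h

/-! ### The pinned negative-branch representation -/

/-- `Q(a, u) = a²(3−a)² − 4ua` as an `MvPolynomial` in `(x 0, x 1) = (u, a)`. [folklore] -/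
def QuPoly : MvPolynomial (Fin 2) ℚ := X 1 ^ 2 * (3 - X 1) ^ 2 - 4 * X 0 * X 1

/-- Evaluating `QuPoly`. [folklore] -/
theorem aeval_QuPoly (x : Fin 2 → ℝ) :
    aeval x QuPoly = (x 1) ^ 2 * (3 - x 1) ^ 2 - 4 * x 0 * x 1 := by
  simp [QuPoly]

/-- The route's negative-branch integrand is `ℚ`-semialgebraic on `Σ_neg` (rational power of `u`
via `KZ.isSemialgebraicFunOn_mellinIntegrand`, square root via the tree's `fun_sqrt`). [folklore] -/
theorem isSemialgebraicFunOn_negFun (s : ℚ) : IsSemialgebraicFunOn ℚ negCell (negFun s) := by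
  have h1 : IsSemialgebraicFunOn ℚ negCell (fun x => (x 0) ^ ((s:ℝ) - 1)) := by
    refine (isSemialgebraicFunOn_mellinIntegrand isSemialgebraic_negCell ![X 0] ![s - 1] 1 ?_).congr
      fun x _ => ?_
    · intro x hx k
      fin_cases k
      simpa using hx.1
    · simp [mellinIntegrand]
  have h2 : IsSemialgebraicFunOn ℚ negCell
      (fun x => Real.sqrt ((x 1) ^ 2 * (3 - x 1) ^ 2 - 4 * x 0 * x 1)) :=
    ((isSemialgebraicFunOn_aeval isSemialgebraic_negCell QuPoly).congr fun x _ => aeval_QuPoly x).fun_sqrt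
  refine (h1.div h2 fun x hx => ?_).congr fun x _ => rfl
  have hQ : 0 < (x 1) ^ 2 * (3 - x 1) ^ 2 - 4 * x 0 * x 1 := by
    have := Qf_pos_of_neg hx.2.2 hx.1
    unfold Qf at this
    linarith
  exact (Real.sqrt_pos.2 hQ).ne'

/-- **The pinned negative-branch representation** `[Σ_neg, u^(s−1)/√(a²(3−a)² − 4ua)]` for rational
`s > 0`: the hypotheses `hr`, `hri` of the item are satisfiable. [folklore] -/
def negRep (s : ℚ) (hs : 0 < s) : IntegralRep 2 where
  domain := negCell
  integrand := negFun s
  isSemialgebraic_domain := isSemialgebraic_negCell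
  isSemialgebraicFunOn_integrand := isSemialgebraicFunOn_negFun s
  integrableOn := integrableOn_negFun hs

/-- Domain of `negRep`. [folklore] -/
@[simp] theorem negRep_domain (s : ℚ) (hs : 0 < s) : (negRep s hs).domain = negCell := rfl

/-- Integrand of `negRep`. [folklore] -/
@[simp] theorem negRep_integrand (s : ℚ) (hs : 0 < s) : (negRep s hs).integrand = negFun s := rfl

/-- **The item, instantiated on the pinned representations**:
`[Σ_neg, u^(s−1)/√Q] ~ [M₃, (σ₁σ₂σ₃)^(s−1)]` as concrete `IntegralRep`s, for every rational `s > 0`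
— the form the `MultiplicationThree` assembly consumes. [folklore] -/
theorem negRep_equivalent_maxRep {s : ℚ} (hs : 0 < s) : Equivalent (negRep s hs) (maxRep s hs) :=
  negativeBranchToMaxCell_proof s hs (negRep s hs) (maxRep s hs) rfl (fun _ _ => rfl) rfl
    fun _ _ => rfl

/-- **Reduction to the pinned pair**: the item is equivalent to its single pinned instance (any two
representations with the pinned domains/integrands differ from `negRep`, `maxRep` by integrand
additivity with a zero representation). [folklore] -/
theorem negativeBranchToMaxCell_iff_pinned :
    Summit.KontsevichZagierPeriods.KontsevichZagierPeriods.Theses.TerasomaMultiplication.NegativeBranchToMaxCell ↔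
      ∀ (s : ℚ) (hs : 0 < s), Equivalent (negRep s hs) (maxRep s hs) := by
  constructor
  · intro h s hs
    exact h s hs (negRep s hs) (maxRep s hs) rfl (fun _ _ => rfl) rfl fun _ _ => rfl
  · intro h s hs r r' hr hri hr' hri'
    have h1 : of r - of (negRep s hs) ∈ relations :=
      of_sub_of_mem_relations_of_eqOn (by rw [hr]; rfl) hri
    have h2 : of (maxRep s hs) - of r' ∈ relations :=
      of_sub_of_mem_relations_of_eqOn (by rw [hr']; rfl) fun x hx => (hri' (by rw [hr']; exact hx)).symm
    have : of r - of r' = (of r - of (negRep s hs)) + (of (negRep s hs) - of (maxRep s hs)) +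
        (of (maxRep s hs) - of r') := by abel
    show of r - of r' ∈ relations
    rw [this]
    exact relations.add_mem (relations.add_mem h1 (h s hs)) h2

end Summit.KontsevichZagierPeriods.TerasomaMultiplication.NegativeBranchToMaxCell

end
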